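import Literature.Barriers.AtomisticToContinuum.DisorderedHarmonicChainPointwise
import Literature.Barriers.AtomisticToContinuum.DisorderedHarmonicChainPotentialUpper
import HarnessLib

/-!
# Ajanki–Huveneers 2011: discharge of the low-frequency upper bound (U)

With the upper bound (5.1) of Prop. 5.1 now a theorem (`potentialTheory_upper`, integration by
parts on the disorder, `…PotentialUpper.lean`), the printed §6.2 derivation of
`…Pointwise.lean` becomes unconditional. This file re-runs that derivation verbatim with the
hypothesis `h5 : AjankiHuveneers2011_potentialTheory` replaced by `potentialTheory_upper` (only
Prop. 5.1's first conjunct is ever used there), and records the discharges: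

* `AjankiHuveneers2011_pointwiseCurrentBound_holds` (§6.2 (6.11)–(6.15));
* `AjankiHuveneers2011_lowFrequencyBound_holds` (U) (`…_lowFrequencyBound_of_pointwise`).

O. Ajanki, F. Huveneers, CMP **301** (2011) 841–883, arXiv:1003.1076, §6.2.
[cite: AjankiHuveneers2011, §6.2 eqs. (6.11), (6.13)-(6.16); Prop. 5.1 eq. (5.1)]
-/

noncomputable section

open MeasureTheory Real

namespace Literature.Barriers.AtomisticToContinuum.HeatConduction

/-! ### (6.14)–(6.15): the conditional expectation, given Prop. 5.1 -/

/-- **The core of (6.13)–(6.15), now unconditional** (Prop. 5.1's upper bound is the theorem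
`potentialTheory_upper`), for a fixed starting point `x` and amplitude `a > 0` of the
restarted chain: "`𝔼(j_n(w) | x, a) ≲ 𝔼{χ_{[0,1]}(w⁻⁴a² sin²πX^x_m) + χ_{]1,∞[}(w⁻⁴a² sin²πX^x_m)
· w⁴ · (aΓ^x_m sin πX^x_m)⁻²}`. Therefore, Proposition 5.1 implies `𝔼(j_n(w) | x, a) ≲
(1/(w√m)) ∫_𝕋 {…} dy ≲ … ≲ (w/√m) a⁻¹`" — here for the kernel `1/(1 + a²Γ²sin²πX_m/(L²w⁴))`,
under `κ ≤ wm`, `w²m ≤ 1`, with Prop. 5.1 (`AjankiHuveneers2011_potentialTheory`) as a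
HYPOTHESIS, applied with `h ≡ 0`, `u = u₁` and with `h = h₂ = -2s`, `u = u₂`
(`Γ_m⁻² ≤ E₀e^{w∑h₂(X)B}`, `ahGamma_inv_sq_le`). The majorant `G` is returned together with its
integrability (part of Prop. 5.1's conclusion). [cite: AjankiHuveneers2011, §6.2 eqs. (6.14)-(6.15)] -/
theorem pointwise_core_upper {τ : ℝ → ℝ} {bm bp : ℝ}
    (hτ : ReducedLawHyp τ bm bp) (ρB : Measure ℝ) [IsProbabilityMeasure ρB]
    (hρ : ρB = volume.withDensity fun s => ENNReal.ofReal (τ s)) {κ : ℝ} (hκ : 0 < κ) {L : ℝ}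
    (hL : 0 < L) :
    ∃ w₀ : ℝ, 0 < w₀ ∧ ∃ K₀ : ℝ, 0 < K₀ ∧ ∀ w ∈ Set.Ioc 0 w₀, ∀ m : ℕ, κ ≤ w * m →
      w ^ 2 * m ≤ 1 → ∀ x a : ℝ, 0 < a →
        ∃ G : (Fin m → ℝ) → ℝ, Integrable G (Measure.pi fun _ : Fin m => ρB) ∧
          (∀ᵐ β ∂(Measure.pi fun _ : Fin m => ρB),
            1 / (1 + a ^ 2 * (ahGamma w x (finExt β) m) ^ 2 *
              Real.sin (π * ahPhase w x (finExt β) m) ^ 2 / (L ^ 2 * w ^ 4)) ≤ G β) ∧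
          ∫ β, G β ∂(Measure.pi fun _ : Fin m => ρB) ≤ K₀ * w / (Real.sqrt m * a) := by
  obtain ⟨K₁, w₁, hK₁, hw₁, h51⟩ :=
    potentialTheory_upper τ bm bp hτ ρB hρ κ hκ (fun _ => 0) (fun _ => rfl) contDiff_const
  obtain ⟨K₂, w₂, hK₂, hw₂, h52⟩ :=
    potentialTheory_upper τ bm bp hτ ρB hρ κ hκ (fun y : ℝ => π * Real.sin (2 * π * y)) periodic_pi_mul_sin
      contDiff_pi_mul_sin
  obtain ⟨w₆, hw₆, E₀, hE₀, hE⟩ := ahGamma_inv_sq_le bm bp hτ.lo hτ.lt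
  have hE₀0 : 0 ≤ E₀ := zero_le_one.trans hE₀
  refine ⟨min (min w₁ w₂) w₆, by positivity, (K₁ + E₀ * K₂) * (π * L), by positivity, ?_⟩
  intro w hw m hκm hwm x a ha
  have hw0 : 0 < w := hw.1
  have hw1 : w ∈ Set.Ioc 0 w₁ := ⟨hw0, hw.2.trans ((min_le_left _ _).trans (min_le_left _ _))⟩
  have hw2 : w ∈ Set.Ioc 0 w₂ := ⟨hw0, hw.2.trans ((min_le_left _ _).trans (min_le_right _ _))⟩
  have hw6 : w ∈ Set.Ioc 0 w₆ := ⟨hw0, hw.2.trans (min_le_right _ _)⟩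
  have hm0 : (0 : ℝ) < m := by
    have h : 0 < w * m := hκ.trans_le hκm
    exact pos_of_mul_pos_right h hw0.le
  have hsm : 0 < Real.sqrt m := Real.sqrt_pos.mpr hm0
  set q : ℝ := L ^ 2 * w ^ 4 with hq
  have hq0 : 0 < q := by positivity
  have hsqrtq : Real.sqrt q = L * w ^ 2 := by
    rw [hq, show L ^ 2 * w ^ 4 = (L * w ^ 2) ^ 2 by ring, Real.sqrt_sq (by positivity)]
  -- the two cut-offs of (6.14)
  set u₁ : ℝ → ℝ := fun y => if a ^ 2 * Real.sin (π * y) ^ 2 ≤ q then 1 else 0 with hu₁def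
  set u₂ : ℝ → ℝ := fun y => if a ^ 2 * Real.sin (π * y) ^ 2 ≤ q then 0 else
    q / (a ^ 2 * Real.sin (π * y) ^ 2) with hu₂def
  have hu₁ : ∀ y, u₁ y = if a ^ 2 * Real.sin (π * y) ^ 2 ≤ q then 1 else 0 := fun y => rfl
  have hu₂ : ∀ y, u₂ y = if a ^ 2 * Real.sin (π * y) ^ 2 ≤ q then 0 else
      q / (a ^ 2 * Real.sin (π * y) ^ 2) := fun y => rfl
  obtain ⟨hI₁, hB₁⟩ := h51 w hw1 u₁ (cut₁_periodic hu₁)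
    (fun y => (cut₁_mem hu₁ y).1) (integrableOn_cut₁ hu₁) x m hκm hwm
  obtain ⟨hI₂, hB₂⟩ := h52 w hw2 u₂ (cut₂_periodic hu₂)
    (fun y => (cut₂_mem hu₂ hq0.le y).1) (integrableOn_cut₂ hu₂ hq0.le) x m hκm hwm
  set G₁ : (Fin m → ℝ) → ℝ := fun B =>
    Real.exp (w * ∑ k ∈ Finset.range m, (fun _ => (0 : ℝ)) (ahPhase w x (finExt B) k) * finExt B k) *
      u₁ (ahPhase w x (finExt B) m) with hG₁
  set G₂ : (Fin m → ℝ) → ℝ := fun B =>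
    Real.exp (w * ∑ k ∈ Finset.range m, π * Real.sin (2 * π * ahPhase w x (finExt B) k) * finExt B k) *
      u₂ (ahPhase w x (finExt B) m) with hG₂
  refine ⟨fun B => G₁ B + E₀ * G₂ B, hI₁.add (hI₂.const_mul E₀), ?_, ?_⟩
  · filter_upwards [ae_pi_mem_Icc hτ.eq_zero hρ m] with β hβ
    have hBk : ∀ k, finExt β k ∈ Set.Icc bm bp := finExt_mem_Icc hτ.bm_nonpos hτ.bp_nonneg hβ
    obtain ⟨hΓpos, hΓ⟩ := hE w hw6 x (finExt β) hBk m hwm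
    have hG₁β : G₁ β = u₁ (ahPhase w x (finExt β) m) := by
      simp [hG₁]
    have h1 := lorentz_le_cut hu₁ hu₂ hq0 hΓpos (ahPhase w x (finExt β) m)
    have hu₂0 := (cut₂_mem hu₂ hq0.le (ahPhase w x (finExt β) m)).1
    calc 1 / (1 + a ^ 2 * (ahGamma w x (finExt β) m) ^ 2 *
          Real.sin (π * ahPhase w x (finExt β) m) ^ 2 / (L ^ 2 * w ^ 4))
        ≤ u₁ (ahPhase w x (finExt β) m) +
            u₂ (ahPhase w x (finExt β) m) * ((ahGamma w x (finExt β) m) ^ 2)⁻¹ := h1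
      _ ≤ u₁ (ahPhase w x (finExt β) m) +
            u₂ (ahPhase w x (finExt β) m) *
              (E₀ * Real.exp (w * ∑ k ∈ Finset.range m,
                π * Real.sin (2 * π * ahPhase w x (finExt β) k) * finExt β k)) :=
          add_le_add le_rfl (mul_le_mul_of_nonneg_left hΓ hu₂0)
      _ = G₁ β + E₀ * G₂ β := by
          rw [hG₁β, hG₂]
          ring
  · have hX : 0 ≤ ∫ y in Set.Ico (0 : ℝ) 1, u₁ y :=
      setIntegral_nonneg measurableSet_Ico fun y _ => (cut₁_mem hu₁ y).1
    have hY : 0 ≤ ∫ y in Set.Ico (0 : ℝ) 1, u₂ y :=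
      setIntegral_nonneg measurableSet_Ico fun y _ => (cut₂_mem hu₂ hq0.le y).1
    have hsum := setIntegral_cut_le hu₁ hu₂ hq0 ha
    have hc1 : 0 ≤ K₁ / (w * Real.sqrt m) := by positivity
    have hc2 : 0 ≤ K₂ / (w * Real.sqrt m) := by positivity
    show ∫ B, G₁ B + E₀ * G₂ B ∂(Measure.pi fun _ : Fin m => ρB) ≤ _
    rw [integral_add hI₁ (hI₂.const_mul E₀), integral_const_mul]
    calc (∫ B, G₁ B ∂(Measure.pi fun _ : Fin m => ρB)) + E₀ * ∫ B, G₂ B ∂(Measure.pi fun _ : Fin m => ρB)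
        ≤ K₁ / (w * Real.sqrt m) * (∫ y in Set.Ico (0 : ℝ) 1, u₁ y) +
            E₀ * (K₂ / (w * Real.sqrt m) * ∫ y in Set.Ico (0 : ℝ) 1, u₂ y) :=
          add_le_add hB₁ (mul_le_mul_of_nonneg_left hB₂ hE₀0)
      _ ≤ (K₁ + E₀ * K₂) / (w * Real.sqrt m) *
            ((∫ y in Set.Ico (0 : ℝ) 1, u₁ y) + ∫ y in Set.Ico (0 : ℝ) 1, u₂ y) := by
          rw [add_div, add_mul, mul_add, mul_add]
          have h1 : 0 ≤ K₁ / (w * Real.sqrt m) * ∫ y in Set.Ico (0 : ℝ) 1, u₂ y :=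
            mul_nonneg hc1 hY
          have h2 : 0 ≤ E₀ * K₂ / (w * Real.sqrt m) * ∫ y in Set.Ico (0 : ℝ) 1, u₁ y := by
            positivity
          have h3 : E₀ * (K₂ / (w * Real.sqrt m) * ∫ y in Set.Ico (0 : ℝ) 1, u₂ y) =
              E₀ * K₂ / (w * Real.sqrt m) * ∫ y in Set.Ico (0 : ℝ) 1, u₂ y := by ring
          linarith
      _ ≤ (K₁ + E₀ * K₂) / (w * Real.sqrt m) * (π * Real.sqrt q / a) :=
          mul_le_mul_of_nonneg_left hsum (by positivity)
      _ = (K₁ + E₀ * K₂) * (π * L) * w / (Real.sqrt m * a) := by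
          rw [hsqrtq]
          field_simp

end Literature.Barriers.AtomisticToContinuum.HeatConduction

namespace Literature.Barriers.AtomisticToContinuum

open MeasureTheory Real HeatConduction

/-! ### The pointwise bound from Prop. 5.1 -/

/-- **AH2011 §6.2, `𝔼[(1 + w⁻²D_n(e₁;w)²)⁻¹] ≲ max{w/√n, w²}e^{-αw²n}` for `c/n ≤ w ≤ w₀` —
DISCHARGE of the named fact `AjankiHuveneers2011_pointwiseCurrentBound`** (the printed derivation
of `…Pointwise.lean`, with Prop. 5.1's upper bound supplied by the theorem
`potentialTheory_upper`; Cor. 3.6, (3.21) and Prop. 4.1 are theorems of the tree). The printed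
chain: (6.11) `1/(1 + w⁻²D_n²) ≲ h(Γ^ϑ_n sin πX^ϑ_n)`; (6.13) condition on the first `n - m`
steps, `m = min{n, ⌊w⁻²⌋}`; (6.14)–(6.15) Prop. 5.1 ⟹ `𝔼(…|x,a) ≲ (w/√m)a⁻¹`; then Prop. 4.1:
`𝔼 ≲ (w/√m)𝔼(1/Γ^ϑ_{n-m}) ≲ (w/√m)e^{-αw²(n-m)} ≲ max{w/√n, w²}e^{-αw²n}` (with `κ = min{c, 1}`
in Prop. 5.1: `wm ≥ c` if `m = n`, `wm ≥ 1/w - w ≥ 1` if `m = ⌊w⁻²⌋`, `w ≤ 1/2`).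
[cite: AjankiHuveneers2011, §6.2 eqs. (6.11), (6.13)-(6.15) and the display before (6.16) (arXiv v1 numbering)] -/
theorem AjankiHuveneers2011_pointwiseCurrentBound_holds : AjankiHuveneers2011_pointwiseCurrentBound := by
  intro τ bm bp hτ ρB _ hρ c hc
  have hbm := hτ.bm_nonpos
  have hbp := hτ.bp_nonneg
  -- constants
  set κ : ℝ := min c 1 with hκ
  have hκ0 : 0 < κ := by positivity
  have hκc : κ ≤ c := min_le_left _ _
  have hκ1 : κ ≤ 1 := min_le_right _ _
  have hL : (0 : ℝ) < 6 * π := by positivity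
  obtain ⟨wD, hwD, K₀, hK₀, hcore⟩ := pointwise_core_upper hτ ρB hρ hκ0 hL
  obtain ⟨w₃, hw₃, α, hα, C₃, h41⟩ := AjankiHuveneers2011_invGammaDecay_holds τ bm bp hτ ρB hρ
  obtain ⟨wE, hwE, hE⟩ := majorant_append_le bm bp hbm hbp
  have hsf := smallFreq_pos bm bp
  set w₀ : ℝ := min (min (min wD w₃) (min wE (smallFreq bm bp))) (1 / 2) with hw₀
  have hw₀pos : 0 < w₀ := by positivity
  set C : ℝ := 2 * K₀ * (|C₃| + 1) * Real.exp α with hC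
  refine ⟨w₀, hw₀pos, α, hα, C, ?_⟩
  intro n hn w hw
  obtain ⟨hwlo, hwhi⟩ := hw
  have hn0 : (0 : ℝ) < n := by exact_mod_cast hn
  have hw0 : 0 < w := lt_of_lt_of_le (by positivity) hwlo
  have hwa : w ≤ min (min wD w₃) (min wE (smallFreq bm bp)) := hwhi.trans (min_le_left _ _)
  have hwD' : w ∈ Set.Ioc 0 wD := ⟨hw0, hwa.trans ((min_le_left _ _).trans (min_le_left _ _))⟩
  have hw3' : w ∈ Set.Ioc 0 w₃ := ⟨hw0, hwa.trans ((min_le_left _ _).trans (min_le_right _ _))⟩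
  have hwE' : w ∈ Set.Ioc 0 wE := ⟨hw0, hwa.trans ((min_le_right _ _).trans (min_le_left _ _))⟩
  have hws : w ≤ smallFreq bm bp := hwa.trans ((min_le_right _ _).trans (min_le_right _ _))
  have hwhalf : w ≤ 1 / 2 := hwhi.trans (min_le_right _ _)
  have hw1 : w ≤ 1 := by linarith
  have hwn : c ≤ w * n := by rwa [div_le_iff₀ hn0] at hwlo
  -- the integrand `F(B) = w²/(w² + D_k(e₁)²) ∈ [0, 1]`
  have hF01 : ∀ (k : ℕ) (B : Fin k → ℝ),
      0 ≤ w ^ 2 / (w ^ 2 + (ahD (ahDiag w (finExt B)) 1 0 k) ^ 2) ∧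
        w ^ 2 / (w ^ 2 + (ahD (ahDiag w (finExt B)) 1 0 k) ^ 2) ≤ 1 :=
    fun k B => reducedMajorant_mem _ _
  have hFint : ∀ k : ℕ, Integrable
      (fun B : Fin k → ℝ => w ^ 2 / (w ^ 2 + (ahD (ahDiag w (finExt B)) 1 0 k) ^ 2))
      (Measure.pi fun _ : Fin k => ρB) := fun k =>
    Integrable.mono' (integrable_const (1 : ℝ)) (measurable_reducedMajorant w k k).aestronglyMeasurable
      (ae_of_all _ fun B => by
        rw [Real.norm_eq_abs, abs_of_nonneg (hF01 k B).1]
        exact (hF01 k B).2)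
  rcases le_or_gt n ⌊w⁻¹ ^ 2⌋₊ with hcase | hcase
  · -- `m = n`: no conditioning, `x = ϑ`, `a = Γ_0 = 1`
    have hwn2 : w ^ 2 * n ≤ 1 := by
      have h1 : (n : ℝ) ≤ ⌊w⁻¹ ^ 2⌋₊ := by exact_mod_cast hcase
      have h2 : (⌊w⁻¹ ^ 2⌋₊ : ℝ) ≤ w⁻¹ ^ 2 := Nat.floor_le (by positivity)
      calc w ^ 2 * n ≤ w ^ 2 * (w⁻¹ ^ 2) := mul_le_mul_of_nonneg_left (h1.trans h2) (sq_nonneg w)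
        _ = 1 := by field_simp
    have hκn : κ ≤ w * n := hκc.trans hwn
    obtain ⟨G, hGi, hGle, hGint⟩ := hcore w hwD' n hκn hwn2 (ahTheta w) 1 one_pos
    calc ∫ B, w ^ 2 / (w ^ 2 + (ahD (ahDiag w (finExt B)) 1 0 n) ^ 2) ∂(Measure.pi fun _ : Fin n => ρB)
        ≤ ∫ B, G B ∂(Measure.pi fun _ : Fin n => ρB) := by
          refine integral_mono_of_nonneg (ae_of_all _ fun B => (hF01 n B).1) hGi ?_
          filter_upwards [hGle, ae_pi_mem_Icc hτ.eq_zero hρ n] with B hB hBrange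
          exact (majorant_le_start hw0 hws hbm hbp hn B hBrange).trans hB
      _ ≤ K₀ * w / (Real.sqrt n * 1) := hGint
      _ ≤ C * max (w / Real.sqrt n) (w ^ 2) * Real.exp (-(α * w ^ 2 * n)) :=
          final_bound_start hK₀.le hα.le hwn2
  · -- `m = ⌊w⁻²⌋ < n`: condition on the first `r = n - m` steps
    set m := ⌊w⁻¹ ^ 2⌋₊ with hm
    have hwinv : 1 ≤ w⁻¹ := (one_le_inv₀ hw0).mpr hw1
    have hm1 : 1 ≤ m := by
      rw [hm, Nat.one_le_floor_iff]
      exact one_le_pow₀ hwinv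
    have hm1' : (1 : ℝ) ≤ m := by exact_mod_cast hm1
    obtain ⟨r, rfl⟩ : ∃ r, n = r + m := ⟨n - m, by omega⟩
    have hr1 : 1 ≤ r := by omega
    have hfloor : (m : ℝ) ≤ w⁻¹ ^ 2 := Nat.floor_le (by positivity)
    have hwm2 : w ^ 2 * m ≤ 1 := by
      calc w ^ 2 * m ≤ w ^ 2 * (w⁻¹ ^ 2) := mul_le_mul_of_nonneg_left hfloor (sq_nonneg w)
        _ = 1 := by field_simp
    have hmlow : w⁻¹ ^ 2 ≤ m + 1 := (Nat.lt_floor_add_one _).le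
    have hmw : 1 ≤ 2 * w ^ 2 * m := by
      -- `m ≥ w⁻² - 1 ≥ w⁻²/2` since `w⁻² ≥ 4`
      have h4 : (4 : ℝ) ≤ w⁻¹ ^ 2 := by nlinarith [hwinv, (le_inv_comm₀ two_pos hw0).mpr (by linarith : w ≤ 2⁻¹)]
      have h5' : w ^ 2 * (w⁻¹ ^ 2) = 1 := by field_simp
      nlinarith [mul_le_mul_of_nonneg_left hmlow (sq_nonneg w), sq_nonneg w,
        mul_le_mul_of_nonneg_left h4 (sq_nonneg w)]
    have hκm : κ ≤ w * m := by
      have h1 : w * (w⁻¹ ^ 2 - 1) ≤ w * m := mul_le_mul_of_nonneg_left (by linarith) hw0.le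
      have h2 : w * (w⁻¹ ^ 2 - 1) = w⁻¹ - w := by field_simp
      have h3 : (2 : ℝ) ≤ w⁻¹ := (le_inv_comm₀ two_pos hw0).mpr (by linarith : w ≤ 2⁻¹)
      linarith
    obtain ⟨hI41, hB41⟩ := h41 w hw3' r (ahTheta w)
    obtain ⟨hΓpos, hEb⟩ := hE w hwE'
    -- the inner (conditional) bound, a.e. in the first block `β`
    have hinner : ∀ᵐ β ∂(Measure.pi fun _ : Fin r => ρB),
        (∫ β', w ^ 2 / (w ^ 2 + (ahD (ahDiag w (finExt (Fin.append β β'))) 1 0 (r + m)) ^ 2)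
            ∂(Measure.pi fun _ : Fin m => ρB)) ≤
          K₀ * w / Real.sqrt m * (ahGamma w (ahTheta w) (finExt β) r)⁻¹ := by
      filter_upwards [ae_pi_mem_Icc hτ.eq_zero hρ r] with β hβ
      have ha : 0 < ahGamma w (ahTheta w) (finExt β) r :=
        hΓpos _ _ _ (finExt_mem_Icc hbm hbp hβ)
      obtain ⟨G, hGi, hGle, hGint⟩ :=
        hcore w hwD' m hκm hwm2 (ahPhase w (ahTheta w) (finExt β) r) _ ha
      calc (∫ β', w ^ 2 / (w ^ 2 + (ahD (ahDiag w (finExt (Fin.append β β'))) 1 0 (r + m)) ^ 2)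
            ∂(Measure.pi fun _ : Fin m => ρB))
          ≤ ∫ β', G β' ∂(Measure.pi fun _ : Fin m => ρB) := by
            refine integral_mono_of_nonneg (ae_of_all _ fun β' => (hF01 _ _).1) hGi ?_
            filter_upwards [hGle, ae_pi_mem_Icc hτ.eq_zero hρ m] with β' hG hβ'
            exact (hEb r m hr1 hm1 β β' hβ hβ').trans hG
        _ ≤ K₀ * w / (Real.sqrt m * ahGamma w (ahTheta w) (finExt β) r) := hGint
        _ = K₀ * w / Real.sqrt m * (ahGamma w (ahTheta w) (finExt β) r)⁻¹ := by
            rw [div_mul_eq_div_div, div_eq_mul_inv]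
    calc ∫ B, w ^ 2 / (w ^ 2 + (ahD (ahDiag w (finExt B)) 1 0 (r + m)) ^ 2)
          ∂(Measure.pi fun _ : Fin (r + m) => ρB)
        = ∫ β, (∫ β', w ^ 2 / (w ^ 2 + (ahD (ahDiag w (finExt (Fin.append β β'))) 1 0 (r + m)) ^ 2)
            ∂(Measure.pi fun _ : Fin m => ρB)) ∂(Measure.pi fun _ : Fin r => ρB) :=
          integral_pi_append ρB r m _ (hFint (r + m))
      _ ≤ ∫ β, K₀ * w / Real.sqrt m * (ahGamma w (ahTheta w) (finExt β) r)⁻¹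
            ∂(Measure.pi fun _ : Fin r => ρB) :=
          integral_mono_of_nonneg (ae_of_all _ fun β => integral_nonneg fun β' => (hF01 _ _).1)
            (hI41.const_mul _) hinner
      _ = K₀ * w / Real.sqrt m * ∫ β, (ahGamma w (ahTheta w) (finExt β) r)⁻¹
            ∂(Measure.pi fun _ : Fin r => ρB) := integral_const_mul _ _
      _ ≤ K₀ * w / Real.sqrt m * (C₃ * Real.exp (-(α * w ^ 2 * r))) :=
          mul_le_mul_of_nonneg_left hB41 (by positivity)
      _ ≤ C * max (w / Real.sqrt ((r + m : ℕ) : ℝ)) (w ^ 2) * Real.exp (-(α * w ^ 2 * ((r + m : ℕ) : ℝ))) :=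
          final_bound_restart hK₀.le hα.le hw0 hm1' hwm2 hmw


/-- **(U) DISCHARGED**: `AjankiHuveneers2011_lowFrequencyBound` — the low-frequency part
`∫_0^{ω₀} 𝔼 j_n ≤ K' n^{-3/2}` of the upper bound of Thm 1.1 — is a theorem.
[cite: AjankiHuveneers2011, §6.2 eqs. (6.10), (6.12), (6.16)] -/
theorem AjankiHuveneers2011_lowFrequencyBound_holds : AjankiHuveneers2011_lowFrequencyBound :=
  AjankiHuveneers2011_lowFrequencyBound_of_pointwise AjankiHuveneers2011_pointwiseCurrentBound_holds

end Literature.Barriers.AtomisticToContinuum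

end
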